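import Mathlib
import HarnessLib
import Summits.Ventures.LatticeQCDFlow.Scoring.AllPairsAcceptanceRatioCLT
import Summits.Ventures.LatticeQCDFlow.Scoring.UStatisticStudentisedCLT
import Summits.Ventures.LatticeQCDFlow.Scoring.SenVariancePerturbation

/-!
# An ERROR BAR for the printed acceptance column, from the printed weights alone: the
# STUDENTISED CLT `√n (Rₙ − acc)·W̄ₙ / (2√V̂ₙ) ⇒ N(0, 1)`, `V̂ₙ` Sen's estimator for the PLUG-IN
# kernel `min(w̃, w̃′) − (Rₙ/2)(w̃ + w̃′)` — asymptotically exact coverage for `acc(p, q)`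

HONEST FRAMING: exact (Metropolis-corrected) sampling algorithms for lattice gauge theory;
figures of merit are autocorrelation/cost numbers at stated couplings and volumes; no
continuum-physics claim.

Venture `LatticeQCDFlow` (cell pub-lqcd), topic `Scoring`; FANOUT row 4 (`s0-u1-b`, rung S0-B).
`Scoring/AllPairsAcceptanceRatioCLT` (imported) proves `√n (Rₙ − acc) ⇒ N(0, 4ζ₁)` for the
printed all-pairs acceptance ratio `Rₙ = Ûₙ/W̄ₙ` of one proposal stream, with
`ζ₁ = ∫ (∫ F′(a, b) dν(b))² dν(a)` the projection variance of the mean-zero kernel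
`F′(a, b) = min(w(a), w(b)) − (acc/2)(w(a) + w(b))` in the NORMALISED weights `w = p/q` — and
left a studentised version NOT CLAIMED ("the printed acceptance column carries no error bar").
This file supplies the error bar.  Everything printed is in UNNORMALISED weights `w̃ = c·w`
(`c = Z` unknown) and `acc` is unknown, so the statistician's kernel is the PLUG-IN
`F̂ᵢⱼ = min(w̃ᵢ, w̃ⱼ) − (Rₙ/2)(w̃ᵢ + w̃ⱼ) = c·(F′ᵢⱼ + tₙ·Kᵢⱼ)`, `K(a, b) = w(a) + w(b)`,
`tₙ = (acc − Rₙ)/2 → 0` almost surely; Sen's estimator is quadratic and scale-covariant, so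
`V̂ₙ(F̂) = c²·V̂ₙ(F′ + tₙK)`, and `V̂ₙ(F′ + tₙK) → ζ₁` in probability by the perturbation transfer
of `Scoring/SenVariancePerturbation` (inputs: `V̂ₙ(F′) → ζ₁`, `V̂ₙ(K) → ζ₁(K)` by
`Scoring/UStatisticVarianceEstimator`, `tₙ → 0` by `Scoring/AllPairsAcceptanceRatioConsistency`).
The unknown scale cancels against the printed mean weight `W̄ₙ = c·W̄ₙʷ`, `W̄ₙʷ → 1`:
`√n (Rₙ − acc)·W̄ₙ/(2√V̂ₙ(F̂)) = √n (Rₙ − acc)·W̄ₙʷ/(2√V̂ₙ(F′ + tₙK))`, and two Slutsky steps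
(`× W̄ₙʷ → 1`, `÷ 2√(· → ζ₁)`) plus the agreement device of `Scoring/UStatisticStudentisedCLT`
give the limit `N(0, 1)`.  Printed counterparts NAMED ONLY (nothing cited as a fact): Arvesen
(1969) Thm 9; Serfling (1980) §5.7.  NEW WORK of the cell; no definition is introduced.

## Content (`ν = μ.withDensity q`, `w = p/q`, `w̃ = c·w`, `acc = ∫∫ min(p(a)q(b), p(b)q(a))`;
## on the prefix of length `n`: `W̄ₙ = Σⱼ w̃ⱼ/n`, `Rₙ = (Σ_{i≠j} min(w̃ᵢ, w̃ⱼ)/(n(n−1)))/W̄ₙ`,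
## `F̂ᵢⱼ = min(w̃ᵢ, w̃ⱼ) − (Rₙ/2)(w̃ᵢ + w̃ⱼ)`, `V̂ₙ = Σᵢ (Ĥᵢ(F̂) − Uₙ(F̂))²/n`)

* `measurable_printedRatio`, `measurable_pluginSenVariance` — measurability bookkeeping;
* **`printedAcceptance_studentised_clt`** — THE THEOREM: `p ≥ 0`, `∫ p = 1`, `p²/q ∈ L¹`,
  `q > 0` integrable, `c > 0`, `ζ₁ > 0`, `Y₁ ∼ N(0, 1)` ⇒
  `√n (Rₙ − acc)·W̄ₙ/(2√V̂ₙ) ⇒ Y₁` in distribution.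

NOT CLAIMED: the degenerate case `ζ₁ = 0`; a rate; finite-sample calibration; any number of ours
re-scored.
-/

noncomputable section

namespace Summit.Ventures.LatticeQCDFlow.Scoring.CardConsistency

open MeasureTheory ProbabilityTheory Finset Real Filter
open scoped Topology Function

/-! ## §1 Measurability bookkeeping -/

section Measurability

variable {Ω : Type*} [MeasurableSpace Ω] {X : Type*} [MeasurableSpace X] {y : ℕ → Ω → X}

/-- The printed all-pairs ratio of a block read through any measurable weight `v` is measurable.
[ours] -/
theorem measurable_printedRatio (hym : ∀ j, Measurable (y j)) {v : X → ℝ} (hv : Measurable v)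
    (n : ℕ) :
    Measurable fun ω => ((∑ z ∈ (univ : Finset (Fin n)).offDiag,
        min (v (y z.1 ω)) (v (y z.2 ω))) / (n * (n - 1) : ℝ)) / ((∑ j : Fin n, v (y j ω)) / n) :=
  (measurable_ustat₂_iid (x := fun (i : Fin n) ω => y i ω) (fun _ => hym _)
    (F := fun a b => min (v a) (v b)) ((hv.comp measurable_fst).min (hv.comp measurable_snd))).div
    ((Finset.measurable_sum _ fun (j : Fin n) _ => hv.comp (hym j)).div_const _)

/-- Sen's estimator for the plug-in kernel `min(vᵢ, vⱼ) − (r/2)(vᵢ + vⱼ)` with a measurable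
random coefficient `r` is measurable. [ours] -/
theorem measurable_pluginSenVariance (hym : ∀ j, Measurable (y j)) {v : X → ℝ}
    (hv : Measurable v) {r : Ω → ℝ} (hr : Measurable r) (n : ℕ) :
    Measurable fun ω => (∑ i : Fin n, ((∑ j ∈ univ.erase i,
        (min (v (y i ω)) (v (y j ω)) - r ω / 2 * (v (y i ω) + v (y j ω)))) / ((n : ℝ) - 1)
      - (∑ z ∈ (univ : Finset (Fin n)).offDiag,
        (min (v (y z.1 ω)) (v (y z.2 ω)) - r ω / 2 * (v (y z.1 ω) + v (y z.2 ω))))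
          / (n * (n - 1) : ℝ)) ^ 2) / (n : ℝ) := by
  have hv' : ∀ i, Measurable fun ω => v (y i ω) := fun i => hv.comp (hym i)
  have he : ∀ i j : ℕ, Measurable fun ω =>
      min (v (y i ω)) (v (y j ω)) - r ω / 2 * (v (y i ω) + v (y j ω)) := fun i j =>
    ((hv' i).min (hv' j)).sub ((hr.div_const 2).mul ((hv' i).add (hv' j)))
  refine Measurable.div_const (Finset.measurable_sum _ fun i _ => ?_) _
  refine Measurable.pow_const (Measurable.sub ?_ ?_) _
  · exact Measurable.div_const (Finset.measurable_sum _ fun (j : Fin n) _ => he i j) _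
  · exact Measurable.div_const
      (Finset.measurable_sum _ fun (z : Fin n × Fin n) _ => he z.1 z.2) _

end Measurability

/-! ## §2 The studentised CLT for the printed acceptance ratio -/

section Studentised

variable {Ω : Type*} [MeasurableSpace Ω] {P : Measure Ω} [IsProbabilityMeasure P]
variable {Ω' : Type*} [MeasurableSpace Ω'] {P' : Measure Ω'} [IsProbabilityMeasure P']
variable {X : Type*} [MeasurableSpace X] {μ : Measure X} [SFinite μ] {p q : X → ℝ}
variable {y : ℕ → Ω → X} {Y₁ : Ω' → ℝ}

/-- **THE STUDENTISED CLT FOR THE PRINTED ACCEPTANCE RATIO (an asymptotically exact error bar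
from the printed weights alone).**  One independent proposal stream `yᵢ` (laws
`ν = μ.withDensity q`); `p ≥ 0` measurable, integrable, `∫ p dμ = 1`, `p²/q ∈ L¹(μ)`; `q > 0`
measurable, integrable; weights printed with ANY normalisation `w̃ = c·p/q`, `c > 0`; the
projection variance `ζ₁ = ∫ (∫ F′(a, b) dν(b))² dν(a)` of the kernel
`F′(a, b) = min(w(a), w(b)) − (acc/2)(w(a) + w(b))` is POSITIVE; `Y₁` any standard normal
variable.  With `W̄ₙ = Σⱼ w̃ⱼ/n`, `Rₙ` the printed all-pairs acceptance ratio, the plug-in kernel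
`F̂ᵢⱼ = min(w̃ᵢ, w̃ⱼ) − (Rₙ/2)(w̃ᵢ + w̃ⱼ)` and Sen's `V̂ₙ = Σᵢ (Ĥᵢ(F̂) − Uₙ(F̂))²/n`:
`√n (Rₙ − acc)·W̄ₙ / (2√V̂ₙ) ⇒ Y₁` in distribution, `acc = ∫∫ min(p(a)q(b), p(b)q(a)) dμ dμ`.
[ours] -/
theorem printedAcceptance_studentised_clt (hym : ∀ j, Measurable (y j)) (hind : iIndepFun y P)
    (hlaw : ∀ j, Measure.map (y j) P = μ.withDensity fun z => ENNReal.ofReal (q z))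
    (hp0 : ∀ z, 0 ≤ p z) (hpm : Measurable p) (hpi : Integrable p μ) (hp1 : ∫ z, p z ∂μ = 1)
    (hq0 : ∀ z, 0 < q z) (hqm : Measurable q) (hqi : Integrable q μ)
    (hM2i : Integrable (fun z => p z ^ 2 / q z) μ) {wt : X → ℝ} {c : ℝ} (hc : 0 < c)
    (hwt : ∀ z, wt z = c * (p z / q z))
    (hζ : 0 < ∫ a, (∫ b, (min (p a / q a) (p b / q b)
        - (∫ a', ∫ b', min (p a' * q b') (p b' * q a') ∂μ ∂μ) / 2 * (p a / q a + p b / q b))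
        ∂(μ.withDensity fun z => ENNReal.ofReal (q z))) ^ 2
        ∂(μ.withDensity fun z => ENNReal.ofReal (q z)))
    (hY1 : HasLaw Y₁ (gaussianReal 0 1) P') :
    TendstoInDistribution (fun (n : ℕ) ω => Real.sqrt n *
        (((∑ z ∈ (univ : Finset (Fin n)).offDiag, min (wt (y z.1 ω)) (wt (y z.2 ω)))
            / (n * (n - 1) : ℝ)) / ((∑ j : Fin n, wt (y j ω)) / n)
          - ∫ a, ∫ b, min (p a * q b) (p b * q a) ∂μ ∂μ)
        * ((∑ j : Fin n, wt (y j ω)) / n)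
        / (2 * Real.sqrt ((∑ i : Fin n, ((∑ j ∈ univ.erase i,
            (min (wt (y i ω)) (wt (y j ω))
              - ((∑ z ∈ (univ : Finset (Fin n)).offDiag, min (wt (y z.1 ω)) (wt (y z.2 ω)))
                  / (n * (n - 1) : ℝ)) / ((∑ j : Fin n, wt (y j ω)) / n) / 2
                * (wt (y i ω) + wt (y j ω)))) / ((n : ℝ) - 1)
          - (∑ z ∈ (univ : Finset (Fin n)).offDiag,
            (min (wt (y z.1 ω)) (wt (y z.2 ω))
              - ((∑ z ∈ (univ : Finset (Fin n)).offDiag, min (wt (y z.1 ω)) (wt (y z.2 ω)))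
                  / (n * (n - 1) : ℝ)) / ((∑ j : Fin n, wt (y j ω)) / n) / 2
                * (wt (y z.1 ω) + wt (y z.2 ω)))) / (n * (n - 1) : ℝ)) ^ 2) / (n : ℝ))))
      atTop Y₁ (fun _ => P) P' := by
  haveI hν : IsProbabilityMeasure (μ.withDensity fun z => ENNReal.ofReal (q z)) := by
    rw [← hlaw 0]
    exact Measure.isProbabilityMeasure_map (hym 0).aemeasurable
  -- the CLT with limit `2·(√ζ₁·Y₁)` and the consistency of `Rₙ`, before abbreviating
  have hYg := hasLaw_sqrt_mul_gaussian hY1 hζ.le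
  have hclt := printedAcceptance_clt (P' := P') hym hind hlaw hp0 hpm hpi hp1 hq0 hqm hqi hM2i
    hc hwt hYg
  have hRae := printedAcceptance_tendsto_ae hym hind hlaw hp0 hpm hpi hp1 hq0 hqm hqi hc hwt
  -- abbreviations: `acc`, `ζ`
  obtain ⟨acc, hacc⟩ : ∃ acc : ℝ, acc = ∫ a, ∫ b, min (p a * q b) (p b * q a) ∂μ ∂μ := ⟨_, rfl⟩
  rw [← hacc] at hζ hclt hRae ⊢
  obtain ⟨ζ, hζdef⟩ : ∃ ζ : ℝ, ζ = ∫ a, (∫ b, (min (p a / q a) (p b / q b)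
      - acc / 2 * (p a / q a + p b / q b)) ∂(μ.withDensity fun z => ENNReal.ofReal (q z))) ^ 2
      ∂(μ.withDensity fun z => ENNReal.ofReal (q z)) := ⟨_, rfl⟩
  rw [← hζdef] at hζ hclt
  have hwm : Measurable fun a => p a / q a := hpm.div hqm
  have hwtm : Measurable wt := by
    have h : wt = fun z => c * (p z / q z) := funext hwt
    rw [h]
    exact hwm.const_mul c
  have hRm : ∀ n : ℕ, Measurable fun ω =>
      ((∑ z ∈ (univ : Finset (Fin n)).offDiag, min (wt (y z.1 ω)) (wt (y z.2 ω)))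
        / (n * (n - 1) : ℝ)) / ((∑ j : Fin n, wt (y j ω)) / n) := fun n =>
    measurable_printedRatio hym hwtm n
  -- (1) the normalised mean weight `W̄ₙʷ → 1`; Slutsky: `√n(Rₙ − acc)·W̄ₙʷ ⇒ 2√ζ·Y₁`
  have hWm : ∀ n : ℕ, Measurable fun ω => (∑ j : Fin n, p (y j ω) / q (y j ω)) / n := fun n =>
    (Finset.measurable_sum _ fun (j : Fin n) _ => hwm.comp (hym j)).div_const _
  have hWae := meanWeight_fin_tendsto_one_ae hym hind hlaw hpm hpi hp1 hq0 hqm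
  have hW : TendstoInMeasure P (fun (n : ℕ) ω => (∑ j : Fin n, p (y j ω) / q (y j ω)) / n)
      atTop (fun _ => (1 : ℝ)) :=
    tendstoInMeasure_of_tendsto_ae (fun n => (hWm n).aestronglyMeasurable) hWae
  have hsl1 := hclt.continuous_comp_prodMk_of_tendstoInMeasure_const
    (g := fun z : ℝ × ℝ => z.1 * z.2) (continuous_fst.mul continuous_snd) hW
    (fun n => (hWm n).aemeasurable)
  -- (2) Sen's estimator for the true kernel `F′` and for `K = w + w′`
  have hFm := measurable_accKernel (X := X) hpm hqm acc
  have hF2 := memLp_accKernel_two (μ := μ) hν hp0 hpm hpi hq0 hqm hM2i acc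
  have hmean : ∫ z, (min (p z.1 / q z.1) (p z.2 / q z.2)
      - acc / 2 * (p z.1 / q z.1 + p z.2 / q z.2))
      ∂((μ.withDensity fun z => ENNReal.ofReal (q z)).prod
        (μ.withDensity fun z => ENNReal.ofReal (q z))) = 0 := by
    rw [hacc]
    exact integral_accKernel_eq_zero hν hp0 hpm hpi hp1 hq0 hqm hqi hM2i
  have hVf := senVariance_tendstoInMeasure (P := P) hym hind hlaw
    (F := fun a b => min (p a / q a) (p b / q b) - acc / 2 * (p a / q a + p b / q b))
    hFm (accKernel_symm acc) hF2
  rw [hmean, zero_pow two_ne_zero, sub_zero, ← hζdef] at hVf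
  obtain ⟨h1, h2⟩ := memLp_fst_snd_of_memLp (AllPairsMedian.memLp_weight_model hpm hq0 hqm hM2i)
  have hVg := senVariance_tendstoInMeasure (P := P) hym hind hlaw
    (F := fun a b => p a / q a + p b / q b)
    ((hwm.comp measurable_fst).add (hwm.comp measurable_snd)) (fun a b => add_comm _ _)
    (h1.add h2)
  -- (3) the plug-in coefficient `tₙ = (acc − Rₙ)/2 → 0` almost surely
  have hT : ∀ᵐ ω ∂P, Tendsto (fun n : ℕ => (acc
      - ((∑ z ∈ (univ : Finset (Fin n)).offDiag, min (wt (y z.1 ω)) (wt (y z.2 ω)))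
          / (n * (n - 1) : ℝ)) / ((∑ j : Fin n, wt (y j ω)) / n)) / 2) atTop (𝓝 0) := by
    filter_upwards [hRae] with ω hR
    have h := ((tendsto_const_nhds (x := acc)).sub hR).div_const 2
    rwa [sub_self, zero_div] at h
  -- (4) transfer: Sen's estimator for the plug-in kernel in NORMALISED weights tends to `ζ`
  have hVpm : ∀ n : ℕ, Measurable fun ω => (∑ i : Fin n, ((∑ j ∈ univ.erase i,
      (min (p (y i ω) / q (y i ω)) (p (y j ω) / q (y j ω))
        - ((∑ z ∈ (univ : Finset (Fin n)).offDiag, min (wt (y z.1 ω)) (wt (y z.2 ω)))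
            / (n * (n - 1) : ℝ)) / ((∑ j : Fin n, wt (y j ω)) / n) / 2
          * (p (y i ω) / q (y i ω) + p (y j ω) / q (y j ω)))) / ((n : ℝ) - 1)
      - (∑ z ∈ (univ : Finset (Fin n)).offDiag,
        (min (p (y z.1 ω) / q (y z.1 ω)) (p (y z.2 ω) / q (y z.2 ω))
          - ((∑ z ∈ (univ : Finset (Fin n)).offDiag, min (wt (y z.1 ω)) (wt (y z.2 ω)))
              / (n * (n - 1) : ℝ)) / ((∑ j : Fin n, wt (y j ω)) / n) / 2
            * (p (y z.1 ω) / q (y z.1 ω) + p (y z.2 ω) / q (y z.2 ω)))) / (n * (n - 1) : ℝ)) ^ 2)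
      / (n : ℝ) := fun n =>
    measurable_pluginSenVariance hym hwm (hRm n) n
  have hVp := tendstoInMeasure_senVariance_perturb (P := P)
    (W := fun n ω => (∑ i : Fin n, ((∑ j ∈ univ.erase i,
      (min (p (y i ω) / q (y i ω)) (p (y j ω) / q (y j ω))
        - ((∑ z ∈ (univ : Finset (Fin n)).offDiag, min (wt (y z.1 ω)) (wt (y z.2 ω)))
            / (n * (n - 1) : ℝ)) / ((∑ j : Fin n, wt (y j ω)) / n) / 2
          * (p (y i ω) / q (y i ω) + p (y j ω) / q (y j ω)))) / ((n : ℝ) - 1)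
      - (∑ z ∈ (univ : Finset (Fin n)).offDiag,
        (min (p (y z.1 ω) / q (y z.1 ω)) (p (y z.2 ω) / q (y z.2 ω))
          - ((∑ z ∈ (univ : Finset (Fin n)).offDiag, min (wt (y z.1 ω)) (wt (y z.2 ω)))
              / (n * (n - 1) : ℝ)) / ((∑ j : Fin n, wt (y j ω)) / n) / 2
            * (p (y z.1 ω) / q (y z.1 ω) + p (y z.2 ω) / q (y z.2 ω)))) / (n * (n - 1) : ℝ)) ^ 2)
      / (n : ℝ))
    (Vf := fun n ω => (∑ i : Fin n, ((∑ j ∈ univ.erase i,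
      (min (p (y i ω) / q (y i ω)) (p (y j ω) / q (y j ω))
        - acc / 2 * (p (y i ω) / q (y i ω) + p (y j ω) / q (y j ω)))) / ((n : ℝ) - 1)
      - (∑ z ∈ (univ : Finset (Fin n)).offDiag,
        (min (p (y z.1 ω) / q (y z.1 ω)) (p (y z.2 ω) / q (y z.2 ω))
          - acc / 2 * (p (y z.1 ω) / q (y z.1 ω) + p (y z.2 ω) / q (y z.2 ω))))
            / (n * (n - 1) : ℝ)) ^ 2) / (n : ℝ))
    (Vg := fun n ω => (∑ i : Fin n, ((∑ j ∈ univ.erase i,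
      (p (y i ω) / q (y i ω) + p (y j ω) / q (y j ω))) / ((n : ℝ) - 1)
      - (∑ z ∈ (univ : Finset (Fin n)).offDiag,
        (p (y z.1 ω) / q (y z.1 ω) + p (y z.2 ω) / q (y z.2 ω))) / (n * (n - 1) : ℝ)) ^ 2)
          / (n : ℝ))
    (T := fun n ω => (acc
      - ((∑ z ∈ (univ : Finset (Fin n)).offDiag, min (wt (y z.1 ω)) (wt (y z.2 ω)))
          / (n * (n - 1) : ℝ)) / ((∑ j : Fin n, wt (y j ω)) / n)) / 2)
    (fun n => (hVpm n).aestronglyMeasurable) hVf hVg hT (fun n ω => by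
      rcases Nat.eq_zero_or_pos n with hn | hn
      · subst hn
        simp
      · exact senVariance_add_smul_sub_le hn _ _ _ _ fun i j => by ring)
  -- (5) Slutsky: `(√n(Rₙ − acc)·W̄ₙʷ) / (2√(max(V̂, ζ/2))) ⇒ Y₁`
  have hden : ∀ v : ℝ, 2 * Real.sqrt (max v (ζ / 2)) ≠ 0 := fun v =>
    mul_ne_zero two_ne_zero (Real.sqrt_pos.2 (lt_max_of_lt_right (half_pos hζ))).ne'
  have hgc : Continuous fun z : ℝ × ℝ => z.1 / (2 * Real.sqrt (max z.2 (ζ / 2))) :=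
    continuous_fst.div (continuous_const.mul (continuous_snd.max continuous_const).sqrt)
      fun z => hden z.2
  have hsl2 := hsl1.continuous_comp_prodMk_of_tendstoInMeasure_const hgc hVp
    (fun n => (hVpm n).aemeasurable)
  have elim : (fun ω' => 2 * (Real.sqrt ζ * Y₁ ω') * 1 / (2 * Real.sqrt (max ζ (ζ / 2)))) = Y₁ := by
    funext ω'
    rw [mul_one, max_eq_left (by linarith), mul_div_mul_left _ _ (two_ne_zero' ℝ), mul_comm,
      mul_div_assoc, div_self (Real.sqrt_pos.2 hζ).ne', mul_one]
  rw [elim] at hsl2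
  -- (6) the printed statistic: measurability, and agreement with the Slutsky statistic
  have hVwm : ∀ n : ℕ, Measurable fun ω => (∑ i : Fin n, ((∑ j ∈ univ.erase i,
      (min (wt (y i ω)) (wt (y j ω))
        - ((∑ z ∈ (univ : Finset (Fin n)).offDiag, min (wt (y z.1 ω)) (wt (y z.2 ω)))
            / (n * (n - 1) : ℝ)) / ((∑ j : Fin n, wt (y j ω)) / n) / 2
          * (wt (y i ω) + wt (y j ω)))) / ((n : ℝ) - 1)
      - (∑ z ∈ (univ : Finset (Fin n)).offDiag,
        (min (wt (y z.1 ω)) (wt (y z.2 ω))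
          - ((∑ z ∈ (univ : Finset (Fin n)).offDiag, min (wt (y z.1 ω)) (wt (y z.2 ω)))
              / (n * (n - 1) : ℝ)) / ((∑ j : Fin n, wt (y j ω)) / n) / 2
            * (wt (y z.1 ω) + wt (y z.2 ω)))) / (n * (n - 1) : ℝ)) ^ 2) / (n : ℝ) := fun n =>
    measurable_pluginSenVariance hym hwtm (hRm n) n
  have hWtm : ∀ n : ℕ, Measurable fun ω => (∑ j : Fin n, wt (y j ω)) / n := fun n =>
    (Finset.measurable_sum _ fun (j : Fin n) _ => hwtm.comp (hym j)).div_const _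
  refine tendstoInDistribution_of_tendstoInMeasure_sub (μ'' := P) (μ' := P') _ Y₁ hsl2 ?_
    (fun n => (((((hRm n).sub_const acc).const_mul (Real.sqrt (n : ℝ))).mul (hWtm n)).div
      ((hVwm n).sqrt.const_mul 2)).aemeasurable)
  refine tendstoInMeasure_sub_zero_of_eqOn hζ hVp fun n ω hVω => ?_
  dsimp only
  rw [max_eq_left hVω.le]
  -- scale covariance: `W̄ₙ = c·W̄ₙʷ`, `V̂ₙ(F̂) = c²·V̂ₙ(F′ + tₙK)`
  have hWscale : (∑ j : Fin n, wt (y j ω)) / n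
      = c * ((∑ j : Fin n, p (y j ω) / q (y j ω)) / n) := by
    simp only [hwt]
    rw [← mul_sum]
    ring
  have hVscale := senVariance_smul
    (f := fun i j : Fin n => min (p (y i ω) / q (y i ω)) (p (y j ω) / q (y j ω))
        - ((∑ z ∈ (univ : Finset (Fin n)).offDiag, min (wt (y z.1 ω)) (wt (y z.2 ω)))
            / (n * (n - 1) : ℝ)) / ((∑ j : Fin n, wt (y j ω)) / n) / 2
          * (p (y i ω) / q (y i ω) + p (y j ω) / q (y j ω)))
    (e := fun i j : Fin n => min (wt (y i ω)) (wt (y j ω))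
        - ((∑ z ∈ (univ : Finset (Fin n)).offDiag, min (wt (y z.1 ω)) (wt (y z.2 ω)))
            / (n * (n - 1) : ℝ)) / ((∑ j : Fin n, wt (y j ω)) / n) / 2
          * (wt (y i ω) + wt (y j ω))) c (fun i j => by
      rw [hwt (y i ω), hwt (y j ω), ← mul_min_of_nonneg _ _ hc.le]
      ring)
  have hsV := (Real.sqrt_pos.2 ((half_pos hζ).trans hVω)).ne'
  rw [hVscale, Real.sqrt_mul (sq_nonneg c), Real.sqrt_sq hc.le]
  -- cancel the unknown scale `c` (only the free-standing mean weight is rewritten)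
  have gen : ∀ A S W₁ W₂ : ℝ, S ≠ 0 → W₁ = c * W₂ →
      A * W₁ / (2 * (c * S)) = A * W₂ / (2 * S) := by
    intro A S W₁ W₂ hS hW
    rw [hW, div_eq_div_iff (mul_ne_zero two_ne_zero (mul_ne_zero hc.ne' hS))
      (mul_ne_zero two_ne_zero hS)]
    ring
  exact gen _ _ _ _ hsV hWscale

end Studentised

end Summit.Ventures.LatticeQCDFlow.Scoring.CardConsistency

end
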